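import Summits.QuantumFields.YangMills.Theorems.FluctuationComparisonRegPrIntLS2BetaWindowCornerQTube
import HarnessLib

/-!
# Crux `FluctuationComparisonRegPrIntL` (stmt-QuantumFields-20520), registry row EXW∘ `WindowExactness` — PER BLOCK SIZE: EXW∘ at `L` ⟸ GAP♯∘ at `L` ∧ Thm 1 at `L`,
# hence at every `L ≥ 5` ⟸ GAP♯∘ at `L` ALONE (the per-`L` THRESHOLD-MERGE edition of w4 g19's ✓`windowExactness_of_gapOrbit_thm1`; ★★OWNER g40 WORD №232 (i′))

Cell `ym3-torus` (YM ladder rung R3 = continuum `SU(2)` Yang–Mills on T³ — a RUNG, NOT d = 4, NOT infinite volume, NOT a mass gap, NOT Clay); seat `ym-line-cst-p1` g39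
(free prover hand); `--supports stmt-QuantumFields-20520 --as helper`, count-neutral, definition-free, default heartbeats; registry v11.4 №36 untouched.

WHAT.  The registered organ row EXW∘ (`Cruxes/FluctuationComparisonRegPrIntL/Lines/semiclassical_s2beta.lean` :715 `WindowExactness`) has, at every interior-window datum `V`
(`PlaqSmall (θBal F.L γ (cw·b₀) p₀ J) V`) of every run `K ≥ J`, two clauses: (1) `minActionRegPr ≤ wilsonAction4 U` for every good-history fine field over `V`;
(2) a print-regular minimiser `U₀ ∈ regFibrePr … ε₀ V` attaining `minActionRegPr` WITH A GOOD HISTORY.  w4 g19 proved (all `L` at once) (2) ⟸ [Balaban1985Variational] Thm 1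
at every odd `L > 1`, and EXW∘ ⟸ {GAP♯∘, Thm 1}; both proofs run per block size.  Since ✓`Thm1GuardedFiveResidueThree.thm1GlobalMinAt_five` makes Thm 1 OUTRIGHT at every
`L ≥ 5`, the per-`L` editions give:
* clause (2) per block size is px13 g19's ✓p793199 `FluctuationComparisonRegPrIntLS2BetaWindowCornerQTube.windowExactnessExistsAt_of_thm1GlobalMinAt (L) (hT_L)` (and
  `windowExactnessExistsAt_five` OUTRIGHT at `L ≥ 5`) — IMPORTED BY NAME, not restated (one copy, №232);
* §1 `windowExactnessAt_of_gapOrbitAt_thm1At (hGap_L) (hT_L) : ⟨EXW∘'s text AT L⟩` — the per-`L` threshold merge (clause (1): GAP♯∘'s excess-action inequality at the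
  clause-(2) minimiser `U₀ ∈ argminHist V` has a non-negative left side; `c₀ := min`, `pS := max`, `ε₁ := min`, `γ₁ := min`), and ★★★ `windowExactnessAt_five_of_gapOrbitAt
  (L) (h5 : 5 ≤ L) (hGap_L)` — **AT EVERY BLOCK SIZE `L ≥ 5` THE ROW EXW∘ READS GAP♯∘ AT `L` AND NOTHING ELSE** (∘ ✓`Thm1GuardedFiveResidueThree.thm1GlobalMinAt_five`).
`hGap_L` = the v11.4 text of `UniformFibreGapOrbit` at one `L` with the two RG-K substitutions of ✓`…S2BetaResidualGaugeOrbit` (exactly w4's `hGap` binder read at `L`).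

HONEST SCOPE (CREDIT NOTHING): per-block-size plumbing over landed theorems (adapted threshold merge, credited in-line); GAP♯∘, EXW∘ for ALL `L` (the registered row — `L = 3` reads Thm 1 at `3`, ✓`windowExactness_of_gapOrbit_thm1AtThree`),
S2β, `FluctuationComparisonRegPrIntL` (20520), `YM3TorusSU2` are NOT proved; no registered stub is closed; rung R3 = SU(2) YM₃ on T³ — NOT d = 4, NOT infinite volume, NOT a
mass gap, NOT Clay; the Yang–Mills mass gap is NOT proved.  Sorry-free, axioms standard.

References: T. Bałaban, CMP **102** (1985) 277–309 [Balaban1985Variational] (Thm 1 (8) p.279, Prop 7 p.299, Prop 8 p.304, (142) p.299); CMP **98** (1985) 17–51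
[Balaban1985Averaging] (Prop. 2 (53) p.26); CMP **102** (1985) 255–275 [Balaban1985UV3] ((7) p.257, (41) p.266).
-/

set_option autoImplicit false

noncomputable section

namespace Summit.QuantumFields.YangMills.Theorems.FluctuationComparisonRegPrIntLWindowExactnessGuardedFive

open Literature.MathematicalPhysics.QuantumFieldTheory.Balaban1983to89
open Literature.MathematicalPhysics.QuantumFieldTheory.Balaban1983to89.T3ContinuumYM3Torus
open Literature.MathematicalPhysics.QuantumFieldTheory.Balaban1983to89.T3UnitLawDensityEML (ℰp)
open Literature.MathematicalPhysics.QuantumFieldTheory.Balaban1983to89.T3UnitScaleTilt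
open Literature.MathematicalPhysics.QuantumFieldTheory.Balaban1983to89.T3TiltDescent
open Literature.MathematicalPhysics.QuantumFieldTheory.Balaban1983to89.T3ConstrainedMinimiser (fibre)
open Literature.MathematicalPhysics.QuantumFieldTheory.Balaban1983to89.T3PrintedRegularMinimiser
open Literature.MathematicalPhysics.QuantumFieldTheory.Balaban1983to89.T3PrintedMinimiserExistence
open Summit.QuantumFields.YangMills.Theorems.Thm1GuardedFiveResidueThree (thm1GlobalMinAt_five)
open Summit.QuantumFields.YangMills.Theorems.FluctuationComparisonRegPrIntLS2BetaWindowCornerQTube (windowExactnessExistsAt_of_thm1GlobalMinAt)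

/-! ## §1 EXW∘ at ONE block size from GAP♯∘ at that block size and Thm 1 there; at `L ≥ 5` from GAP♯∘ alone -/

/-- **EXW∘ AT ONE BLOCK SIZE ⟸ GAP♯∘ AT THAT BLOCK SIZE + THM 1 THERE** — the per-`L` edition of ✓`windowExactness_of_gapOrbit_thm1` (clause (2) = px13 g19's ✓`windowExactnessExistsAt_of_thm1GlobalMinAt`; clause (1): GAP♯∘'s
excess-action inequality at that minimiser `U₀ ∈ argminHist V` bounds `wilsonAction4 U − minActionRegPr` below by `μ·L^{−2(K−J)}·⨅_w Σ dist1² ≥ 0`; thresholds merged by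
`min`∕`max`).  `hGap_L` = the v11.4 `UniformFibreGapOrbit` text at `L` with the RG-K substitutions. [cite: Balaban1985Variational, Thm 1 (8)-(10) p.279 and (142) p.299] -/
theorem windowExactnessAt_of_gapOrbitAt_thm1At {L : ℕ}
    (hGap_L : ∃ c₀ : ℝ, 0 < c₀ ∧ c₀ ≤ 1 ∧ ∀ (cw : ℝ), 0 < cw → cw ≤ c₀ → ∃ pS : ℝ, ∀ (b₀ p₀ : ℝ), 0 < b₀ → pS ≤ p₀ → 0 < p₀ →
      ∃ ε₁ : ℝ, 0 < ε₁ ∧ ∀ (ε₀ : ℝ), 0 < ε₀ → ε₀ ≤ ε₁ →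
      ∃ γ₁ : ℝ, 0 < γ₁ ∧ ∃ μ : ℝ, 0 < μ ∧ ∀ (F : T3Family) (γ : ℝ), F.L = L → 0 < γ → γ ≤ γ₁ →
        ∀ (J K : ℕ) (hJK : J ≤ K) (V : GaugeField (F.P J) 0 (Matrix.specialUnitaryGroup (Fin 2) ℂ)), PlaqSmall (θBal F.L γ (cw * b₀) p₀ J) V →
          ∀ U₀ ∈ {U' | U' ∈ fibre F ℰp J K hJK V ∧ U' ∈ histGood F ℰp (θBal F.L γ b₀ p₀) K J ∧
              wilsonAction4 U' = minActionRegPr F J K hJK ε₀ V},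
            ∀ U ∈ fibre F ℰp J K hJK V, U ∈ histGood F ℰp (θBal F.L γ b₀ p₀) K J →
              μ * ((F.L : ℝ)⁻¹) ^ (2 * (K - J)) *
                  (⨅ w : {w : Site (F.P K) 0 → Matrix.specialUnitaryGroup (Fin 2) ℂ |
                      ∀ U : GaugeField (F.P K) 0 (Matrix.specialUnitaryGroup (Fin 2) ℂ),
                        descendTo F ℰp J K hJK (GaugeField.gaugeAct w U) = descendTo F ℰp J K hJK U},
                    ∑ ℓ : PBond (F.P K) 0,
                      dist1 (U ℓ * ((GaugeField.gaugeAct (w : Site (F.P K) 0 → Matrix.specialUnitaryGroup (Fin 2) ℂ) U₀) ℓ)⁻¹) ^ 2)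
                ≤ wilsonAction4 U - minActionRegPr F J K hJK ε₀ V)
    (hT_L : ∃ a₀ a₁ B₃ : ℝ, 0 < a₀ ∧ 0 < a₁ ∧ 0 < B₃ ∧ Thm1GlobalMinAt L a₀ a₁ B₃) :
    ∃ c₀ : ℝ, 0 < c₀ ∧ c₀ ≤ 1 ∧ ∀ (cw : ℝ), 0 < cw → cw ≤ c₀ → ∃ pS : ℝ, ∀ (b₀ p₀ : ℝ), 0 < b₀ → pS ≤ p₀ → 0 < p₀ → ∃ ε₁ : ℝ, 0 < ε₁ ∧ ∀ (ε₀ : ℝ), 0 < ε₀ → ε₀ ≤ ε₁ →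
    ∃ γ₁ : ℝ, 0 < γ₁ ∧ ∀ (F : T3Family) (γ : ℝ), F.L = L → 0 < γ → γ ≤ γ₁ →
      ∀ (J K : ℕ) (hJK : J ≤ K) (V : GaugeField (F.P J) 0 (Matrix.specialUnitaryGroup (Fin 2) ℂ)), PlaqSmall (θBal F.L γ (cw * b₀) p₀ J) V →
        (∀ U ∈ fibre F ℰp J K hJK V, U ∈ histGood F ℰp (θBal F.L γ b₀ p₀) K J →
            minActionRegPr F J K hJK ε₀ V ≤ wilsonAction4 U) ∧
        (∃ U₀ ∈ regFibrePr F J K hJK ε₀ V, U₀ ∈ histGood F ℰp (θBal F.L γ b₀ p₀) K J ∧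
            wilsonAction4 U₀ = minActionRegPr F J K hJK ε₀ V) := by
  -- adapted from ✓`FluctuationComparisonRegPrIntLWindowExactnessOfGapOrbitThm1.windowExactness_of_gapOrbit_thm1` (`hEx L` ↦ px13's per-L §1, `hGap L` ↦ `hGap_L`)
  obtain ⟨c₁, hc₁, hc₁1, h₁⟩ := windowExactnessExistsAt_of_thm1GlobalMinAt L hT_L
  obtain ⟨c₂, hc₂, -, h₂⟩ := hGap_L
  refine ⟨min c₁ c₂, lt_min hc₁ hc₂, (min_le_left _ _).trans hc₁1, fun cw hcw0 hcwle => ?_⟩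
  obtain ⟨pS₁, h₁'⟩ := h₁ cw hcw0 (hcwle.trans (min_le_left _ _))
  obtain ⟨pS₂, h₂'⟩ := h₂ cw hcw0 (hcwle.trans (min_le_right _ _))
  refine ⟨max pS₁ pS₂, fun b₀ p₀ hb hpS hp => ?_⟩
  obtain ⟨ε₁, hε₁, h₁''⟩ := h₁' b₀ p₀ hb ((le_max_left _ _).trans hpS) hp
  obtain ⟨ε₂, hε₂, h₂''⟩ := h₂' b₀ p₀ hb ((le_max_right _ _).trans hpS) hp
  refine ⟨min ε₁ ε₂, lt_min hε₁ hε₂, fun ε₀ hε₀ hε₀le => ?_⟩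
  obtain ⟨γ₁, hγ₁, H₁⟩ := h₁'' ε₀ hε₀ (hε₀le.trans (min_le_left _ _))
  obtain ⟨γ₂, hγ₂, μ, hμ, H₂⟩ := h₂'' ε₀ hε₀ (hε₀le.trans (min_le_right _ _))
  refine ⟨min γ₁ γ₂, lt_min hγ₁ hγ₂, fun F γ hFL hγ hγle J K hJK V hV => ?_⟩
  obtain ⟨U₀, hU₀reg, hU₀good, hU₀min⟩ := H₁ F γ hFL hγ (hγle.trans (min_le_left _ _)) J K hJK V hV
  refine ⟨fun U hU hUg => ?_, U₀, hU₀reg, hU₀good, hU₀min⟩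
  have hU₀arg : U₀ ∈ {U' | U' ∈ fibre F ℰp J K hJK V ∧ U' ∈ histGood F ℰp (θBal F.L γ b₀ p₀) K J ∧
      wilsonAction4 U' = minActionRegPr F J K hJK ε₀ V} :=
    ⟨((mem_regFibrePr_iff F).mp hU₀reg).1, hU₀good, hU₀min⟩
  have hmain := H₂ F γ hFL hγ (hγle.trans (min_le_right _ _)) J K hJK V hV U₀ hU₀arg U hU hUg
  have hLpos : (0 : ℝ) < (F.L : ℝ) := Nat.cast_pos.mpr (lt_trans zero_lt_one F.hL.2)
  have hnn : 0 ≤ μ * ((F.L : ℝ)⁻¹) ^ (2 * (K - J)) *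
      (⨅ w : {w : Site (F.P K) 0 → Matrix.specialUnitaryGroup (Fin 2) ℂ |
          ∀ U : GaugeField (F.P K) 0 (Matrix.specialUnitaryGroup (Fin 2) ℂ),
            descendTo F ℰp J K hJK (GaugeField.gaugeAct w U) = descendTo F ℰp J K hJK U},
        ∑ ℓ : PBond (F.P K) 0,
          dist1 (U ℓ * ((GaugeField.gaugeAct (w : Site (F.P K) 0 → Matrix.specialUnitaryGroup (Fin 2) ℂ) U₀) ℓ)⁻¹) ^ 2) :=
    mul_nonneg (mul_pos hμ (pow_pos (inv_pos.mpr hLpos) _)).le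
      (Real.iInf_nonneg fun w => Finset.sum_nonneg fun ℓ _ => sq_nonneg _)
  linarith

/-- ★★★ **AT EVERY BLOCK SIZE `L ≥ 5` THE ROW EXW∘ READS GAP♯∘ AT `L` AND NOTHING ELSE** (§1 on ✓`thm1GlobalMinAt_five`).
[cite: Balaban1985Variational, Thm 1 (8)-(10) p.279 and (142) p.299] -/
theorem windowExactnessAt_five_of_gapOrbitAt (L : ℕ) (h5 : 5 ≤ L)
    (hGap_L : ∃ c₀ : ℝ, 0 < c₀ ∧ c₀ ≤ 1 ∧ ∀ (cw : ℝ), 0 < cw → cw ≤ c₀ → ∃ pS : ℝ, ∀ (b₀ p₀ : ℝ), 0 < b₀ → pS ≤ p₀ → 0 < p₀ →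
      ∃ ε₁ : ℝ, 0 < ε₁ ∧ ∀ (ε₀ : ℝ), 0 < ε₀ → ε₀ ≤ ε₁ →
      ∃ γ₁ : ℝ, 0 < γ₁ ∧ ∃ μ : ℝ, 0 < μ ∧ ∀ (F : T3Family) (γ : ℝ), F.L = L → 0 < γ → γ ≤ γ₁ →
        ∀ (J K : ℕ) (hJK : J ≤ K) (V : GaugeField (F.P J) 0 (Matrix.specialUnitaryGroup (Fin 2) ℂ)), PlaqSmall (θBal F.L γ (cw * b₀) p₀ J) V →
          ∀ U₀ ∈ {U' | U' ∈ fibre F ℰp J K hJK V ∧ U' ∈ histGood F ℰp (θBal F.L γ b₀ p₀) K J ∧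
              wilsonAction4 U' = minActionRegPr F J K hJK ε₀ V},
            ∀ U ∈ fibre F ℰp J K hJK V, U ∈ histGood F ℰp (θBal F.L γ b₀ p₀) K J →
              μ * ((F.L : ℝ)⁻¹) ^ (2 * (K - J)) *
                  (⨅ w : {w : Site (F.P K) 0 → Matrix.specialUnitaryGroup (Fin 2) ℂ |
                      ∀ U : GaugeField (F.P K) 0 (Matrix.specialUnitaryGroup (Fin 2) ℂ),
                        descendTo F ℰp J K hJK (GaugeField.gaugeAct w U) = descendTo F ℰp J K hJK U},
                    ∑ ℓ : PBond (F.P K) 0,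
                      dist1 (U ℓ * ((GaugeField.gaugeAct (w : Site (F.P K) 0 → Matrix.specialUnitaryGroup (Fin 2) ℂ) U₀) ℓ)⁻¹) ^ 2)
                ≤ wilsonAction4 U - minActionRegPr F J K hJK ε₀ V) :
    ∃ c₀ : ℝ, 0 < c₀ ∧ c₀ ≤ 1 ∧ ∀ (cw : ℝ), 0 < cw → cw ≤ c₀ → ∃ pS : ℝ, ∀ (b₀ p₀ : ℝ), 0 < b₀ → pS ≤ p₀ → 0 < p₀ → ∃ ε₁ : ℝ, 0 < ε₁ ∧ ∀ (ε₀ : ℝ), 0 < ε₀ → ε₀ ≤ ε₁ →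
    ∃ γ₁ : ℝ, 0 < γ₁ ∧ ∀ (F : T3Family) (γ : ℝ), F.L = L → 0 < γ → γ ≤ γ₁ →
      ∀ (J K : ℕ) (hJK : J ≤ K) (V : GaugeField (F.P J) 0 (Matrix.specialUnitaryGroup (Fin 2) ℂ)), PlaqSmall (θBal F.L γ (cw * b₀) p₀ J) V →
        (∀ U ∈ fibre F ℰp J K hJK V, U ∈ histGood F ℰp (θBal F.L γ b₀ p₀) K J →
            minActionRegPr F J K hJK ε₀ V ≤ wilsonAction4 U) ∧
        (∃ U₀ ∈ regFibrePr F J K hJK ε₀ V, U₀ ∈ histGood F ℰp (θBal F.L γ b₀ p₀) K J ∧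
            wilsonAction4 U₀ = minActionRegPr F J K hJK ε₀ V) :=
  windowExactnessAt_of_gapOrbitAt_thm1At hGap_L (thm1GlobalMinAt_five L h5)

end Summit.QuantumFields.YangMills.Theorems.FluctuationComparisonRegPrIntLWindowExactnessGuardedFive

end
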